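import Summits.KontsevichZagierPeriods.KontsevichZagierPeriods.Theorems.KzOnePeriodsG2SQuotient
import Mathlib.Analysis.SpecialFunctions.Trigonometric.Deriv

/-!
# G2S derivations, part 5: kz1p's real ovals as `C¹` loops, and their CM partners

Sub-problem `KzOnePeriods` (Huber–Wüstholz [cite: HuberWustholz2022, Thm 13.3 (2) (p. 121)]).  The
relation theorems of parts 3–4 quantify over `C¹` paths with algebraic end points on the plane model
`C_{a,b,c} : y² = f(x) = x⁶ + a x⁴ + b x² + c`; this file shows they are not vacuous on kz1p's closed
cycles by constructing those cycles:

* `exists_ovalPath` — for `f = (x² − r₁)(x² − r₂)(x² − r₃)`, `0 < r₁ < r₂ < r₃`, the **real oval over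
  `[√r₁, √r₂]`** (`f ≥ 0` there) as the `C¹` loop `x = m + h cos 2πt`,
  `y = ε h sin 2πt · √(−Q(x))`, `m = (√r₁ + √r₂)/2`, `h = (√r₂ − √r₁)/2`,
  `Q(x) = (x + √r₁)(x + √r₂)(x² − r₃) < 0`, based at the branch point `(√r₂, 0)` and passing through
  `(√r₁, 0)` at `t = ½` (`(x − √r₁)(x − √r₂) = −h² sin² 2πt`): kz1p's lift `c₁₂^±` of the segment
  `[√r₁, √r₂]`, without corners at the branch points.
* `exists_partnerPath` — when the three roots are in arithmetic progression (`r₁ + r₃ = 2r₂`: the curve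
  is the bielliptic cover `φ_{−r₂} = (x² − r₂, y)` of `E : Y² = X³ − e²X`, `e = r₂ − r₁`, `j = 1728`), the
  **CM partner** `(√(2r₂ − x²), i·y)` of a real path inside `x² < 2r₂` is a `C¹` path on `C_{a,b,c}`
  with `x₂² − r₂ = −(x₁² − r₂)`, `y₂ = i·y₁`; applied to the oval over `[√r₁, √r₂]` it is the oval over
  `[√r₂, √r₃]` with purely imaginary `y` — kz1p's `c₂₃^±`.
* `exists_cmPartnerPair`, `relation_ovals` — the two loops together, and (part 4, `relation_cmPartner`)
  `∫_{γ₂} x dx/2y = i·∫_{γ₁} x dx/2y`: the shape of corpus relation G2-01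
  (`y² = (x² − 18)(x² − 24)(x² − 30)`).

No definitions, no new axioms, no statement of the programme cited.
-/

noncomputable section

open MvPolynomial Set Complex Filter Topology
open Literature.NumberTheory.Transcendental Literature.NumberTheory.Transcendental.CurvePeriods
open Summit.KontsevichZagierPeriods.KzOnePeriods.E1Derivation

namespace Summit.KontsevichZagierPeriods.KzOnePeriods.G2SDerivation

/-- The period `∫_γ ω` of the symbol `(Z, ω, γ)`. -/
local notation3 (prettyPrint := false) "Pe[" Z ", " hZ ", " ω ", " h ", " γ "]" =>
  PeriodSymbol.period (⟨Z, hZ, ω, h, γ⟩ : PeriodSymbol)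

/-- The even sextic `f = x⁶ + a x⁴ + b x² + c ∈ ℂ[x, y]`. -/
local notation3 (prettyPrint := false) "fS[" a ", " b ", " c "]" =>
  ((X 0 : MvPolynomial (Fin 2) ℂ) ^ 6 + C a * X 0 ^ 4 + C b * X 0 ^ 2 + C c)

/-- The affine plane model `C_{a,b,c} = {y² = f(x)} ⊂ 𝔸²`. -/
local notation3 (prettyPrint := false) "Cpl[" a ", " b ", " c "]" =>
  (⟨2, 1, ![(X 1 : MvPolynomial (Fin 2) ℂ) ^ 2 - fS[a, b, c]]⟩ : CurveData)

/-- The polynomial `Σ_k π_k x^k ∈ ℂ[x, y]` with coefficient vector `π`. -/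
local notation3 (prettyPrint := false) "Pol[" π "]" =>
  (∑ k, C (π k) * (X 0 : MvPolynomial (Fin 2) ℂ) ^ (k : ℕ))

/-- The even polynomial `U = Σ_{k<3} μ_k x^{2k}` (Bézout cofactor of `f`). -/
local notation3 (prettyPrint := false) "Upol[" μ "]" =>
  (∑ k : Fin 3, C (μ k) * (X 0 : MvPolynomial (Fin 2) ℂ) ^ (2 * (k : ℕ)))

/-- The odd polynomial `V = Σ_{k<3} ν_k x^{2k+1}` (Bézout cofactor of `f′`). -/
local notation3 (prettyPrint := false) "Vpol[" ν "]" =>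
  (∑ k : Fin 3, C (ν k) * (X 0 : MvPolynomial (Fin 2) ℂ) ^ (2 * (k : ℕ) + 1))

/-- `θ[μ, ν, π] = (½ P U y) dx + (P V) dy`, the polynomial representative of `P(x) dx/(2y)`. -/
local notation3 (prettyPrint := false) "θ[" μ ", " ν ", " π "]" =>
  (![C (1 / 2 : ℂ) * Pol[π] * Upol[μ] * X 1, Pol[π] * Vpol[ν]] :
    Fin 2 → MvPolynomial (Fin 2) ℂ)

/-- The Bézout identity `U f + V f′ = 1` (scalar form). -/
local notation3 (prettyPrint := false) "Bez[" a ", " b ", " c ", " μ ", " ν "]" =>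
  (∀ x : ℂ, (∑ k : Fin 3, μ k * x ^ (2 * (k : ℕ))) * (x ^ 6 + a * x ^ 4 + b * x ^ 2 + c) +
    (∑ k : Fin 3, ν k * x ^ (2 * (k : ℕ) + 1)) * (6 * x ^ 5 + 4 * a * x ^ 3 + 2 * b * x) = 1)

/-- `P = x` (scalar form). -/
local notation3 (prettyPrint := false) "IsX[" π "]" => (∀ x : ℂ, ∑ k, π k * x ^ (k : ℕ) = x)

variable {a b c : ℂ}

/-- The square root of a non-negative real algebraic number is algebraic. -/
theorem isAlgebraic_sqrt {r : ℝ} (hr : 0 ≤ r) (h : IsAlgebraic ℚ (r : ℂ)) :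
    IsAlgebraic ℚ ((√r : ℝ) : ℂ) :=
  IsAlgebraic.of_pow two_pos (by rw [← ofReal_pow, Real.sq_sqrt hr]; exact h)

/-! ### The real oval over `[√r₁, √r₂]` -/

/-- **The real oval over `[√r₁, √r₂]` as a `C¹` loop.**  For `f(x) = (x² − r₁)(x² − r₂)(x² − r₃)` with
`0 < r₁ < r₂ < r₃` and `r₂ ∈ ℚ̄`, and a sign `ε = ±1`, there are `C¹` functions
`x(t) = m + h cos 2πt`, `y(t) = ε h sin 2πt · √(−(x + √r₁)(x + √r₂)(x² − r₃))` (`m = (√r₁ + √r₂)/2`,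
`h = (√r₂ − √r₁)/2`) such that `t ↦ (x(t), y(t))` is a path on `C_{a,b,c}` (indeed `y² = f(x)` for all
`t`), closed and based at the branch point `(√r₂, 0)`, through `(√r₁, 0)` at `t = ½`, with
`√r₁ ≤ x ≤ √r₂` throughout. -/
theorem exists_ovalPath {A B C₀ r₁ r₂ r₃ ε : ℝ} (ha : a = A) (hb : b = B) (hc : c = C₀)
    (hfac : ∀ X : ℝ, X ^ 6 + A * X ^ 4 + B * X ^ 2 + C₀ = (X ^ 2 - r₁) * (X ^ 2 - r₂) * (X ^ 2 - r₃))
    (h₁ : 0 < r₁) (h₁₂ : r₁ < r₂) (h₂₃ : r₂ < r₃) (hε : ε = 1 ∨ ε = -1)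
    (hr₂ : IsAlgebraic ℚ (r₂ : ℂ)) :
    ∃ (x y : ℝ → ℝ) (γ : CurvePath Cpl[a, b, c]), ContDiff ℝ 1 x ∧ ContDiff ℝ 1 y ∧
      (∀ t, γ.toFun t = ![(x t : ℂ), (y t : ℂ)]) ∧
      (∀ t, x t = (√r₁ + √r₂) / 2 + (√r₂ - √r₁) / 2 * Real.cos (2 * Real.pi * t)) ∧
      (∀ t, y t = ε * ((√r₂ - √r₁) / 2) * Real.sin (2 * Real.pi * t) *
        √(-((x t + √r₁) * (x t + √r₂) * (x t ^ 2 - r₃)))) ∧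
      (x 0 = √r₂ ∧ y 0 = 0) ∧ (x 1 = √r₂ ∧ y 1 = 0) ∧ (x (1 / 2) = √r₁ ∧ y (1 / 2) = 0) ∧
      ∀ t, √r₁ ≤ x t ∧ x t ≤ √r₂ := by
  subst ha hb hc
  have hp0 : 0 < √r₁ := Real.sqrt_pos.2 h₁
  have hpq : √r₁ < √r₂ := Real.sqrt_lt_sqrt h₁.le h₁₂
  have hp2 : √r₁ ^ 2 = r₁ := Real.sq_sqrt h₁.le
  have hq2 : √r₂ ^ 2 = r₂ := Real.sq_sqrt (h₁.le.trans h₁₂.le)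
  have hε2 : ε ^ 2 = 1 := by rcases hε with rfl | rfl <;> norm_num
  obtain ⟨x, hx⟩ : ∃ x : ℝ → ℝ,
      x = fun t => (√r₁ + √r₂) / 2 + (√r₂ - √r₁) / 2 * Real.cos (2 * Real.pi * t) := ⟨_, rfl⟩
  have hxt : ∀ t, x t = (√r₁ + √r₂) / 2 + (√r₂ - √r₁) / 2 * Real.cos (2 * Real.pi * t) :=
    fun t => by rw [hx]
  have hxb : ∀ t, √r₁ ≤ x t ∧ x t ≤ √r₂ := fun t => by
    have hc1 := Real.neg_one_le_cos (2 * Real.pi * t)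
    have hc2 := Real.cos_le_one (2 * Real.pi * t)
    rw [hxt]
    constructor <;> nlinarith
  have hQ : ∀ t, 0 < -((x t + √r₁) * (x t + √r₂) * (x t ^ 2 - r₃)) := fun t => by
    obtain ⟨hl, hu⟩ := hxb t
    have hsq : x t ^ 2 ≤ √r₂ ^ 2 := pow_le_pow_left₀ (by linarith) hu 2
    rw [hq2] at hsq
    have hneg : (x t + √r₁) * (x t + √r₂) * (x t ^ 2 - r₃) < 0 :=
      mul_neg_of_pos_of_neg (mul_pos (by linarith) (by linarith)) (by linarith)
    linarith
  obtain ⟨y, hy⟩ : ∃ y : ℝ → ℝ, y = fun t => ε * ((√r₂ - √r₁) / 2) * Real.sin (2 * Real.pi * t) *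
      √(-((x t + √r₁) * (x t + √r₂) * (x t ^ 2 - r₃))) := ⟨_, rfl⟩
  have hyt : ∀ t, y t = ε * ((√r₂ - √r₁) / 2) * Real.sin (2 * Real.pi * t) *
      √(-((x t + √r₁) * (x t + √r₂) * (x t ^ 2 - r₃))) := fun t => by rw [hy]
  have hxC : ContDiff ℝ 1 x := by
    rw [hx]
    exact contDiff_const.add (contDiff_const.mul
      (Real.contDiff_cos.comp (contDiff_const.mul contDiff_id)))
  have hQC : ContDiff ℝ 1 fun t => -((x t + √r₁) * (x t + √r₂) * (x t ^ 2 - r₃)) :=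
    (((hxC.add contDiff_const).mul (hxC.add contDiff_const)).mul
      ((hxC.pow 2).sub contDiff_const)).neg
  have hyC : ContDiff ℝ 1 y := by
    rw [hy]
    exact ((contDiff_const.mul (Real.contDiff_sin.comp (contDiff_const.mul contDiff_id))).mul
      (hQC.sqrt fun t => (hQ t).ne'))
  -- the curve equation holds for every `t`
  have hcurve : ∀ t, y t ^ 2 = x t ^ 6 + A * x t ^ 4 + B * x t ^ 2 + C₀ := fun t => by
    rw [hfac]
    have hS := Real.sin_sq_add_cos_sq (2 * Real.pi * t)
    have hW : (√(-((x t + √r₁) * (x t + √r₂) * (x t ^ 2 - r₃)))) ^ 2 =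
        -((x t + √r₁) * (x t + √r₂) * (x t ^ 2 - r₃)) := Real.sq_sqrt (hQ t).le
    have hX := hxt t
    have hY := hyt t
    linear_combination (y t + ε * ((√r₂ - √r₁) / 2) * Real.sin (2 * Real.pi * t) *
        √(-((x t + √r₁) * (x t + √r₂) * (x t ^ 2 - r₃)))) * hY +
      (((√r₂ - √r₁) / 2) ^ 2 * Real.sin (2 * Real.pi * t) ^ 2 *
        (√(-((x t + √r₁) * (x t + √r₂) * (x t ^ 2 - r₃)))) ^ 2) * hε2 +
      (((√r₂ - √r₁) / 2) ^ 2 * Real.sin (2 * Real.pi * t) ^ 2) * hW +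
      (-((x t + √r₁) * (x t + √r₂) * (x t ^ 2 - r₃)) * ((√r₂ - √r₁) / 2) ^ 2) * hS +
      (-((x t + √r₁) * (x t + √r₂) * (x t ^ 2 - r₃)) *
        (x t - (√r₁ + √r₂) / 2 + (√r₂ - √r₁) / 2 * Real.cos (2 * Real.pi * t))) * hX +
      (-(x t ^ 2 - r₂) * (x t ^ 2 - r₃)) * hp2 + (-(x t ^ 2 - √r₁ ^ 2) * (x t ^ 2 - r₃)) * hq2
  have hπ1 : 2 * Real.pi * (1 / 2 : ℝ) = Real.pi := by ring
  have hx0 : x 0 = √r₂ := by rw [hxt, mul_zero, Real.cos_zero]; ring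
  have hx1 : x 1 = √r₂ := by rw [hxt, mul_one, Real.cos_two_pi]; ring
  have hxh : x (1 / 2) = √r₁ := by rw [hxt, hπ1, Real.cos_pi]; ring
  have hy0 : y 0 = 0 := by rw [hyt, mul_zero, Real.sin_zero]; ring
  have hy1 : y 1 = 0 := by rw [hyt, mul_one, Real.sin_two_pi]; ring
  have hyh : y (1 / 2) = 0 := by rw [hyt, hπ1, Real.sin_pi]; ring
  have hq_alg : IsAlgebraic ℚ ((√r₂ : ℝ) : ℂ) := isAlgebraic_sqrt (h₁.le.trans h₁₂.le) hr₂
  obtain ⟨φ, hφ⟩ : ∃ φ : ℝ → Fin 2 → ℂ, φ = fun t => ![(x t : ℂ), (y t : ℂ)] := ⟨_, rfl⟩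
  have e0 : (fun t : ℝ => ((x t : ℝ) : ℂ)) = ⇑Complex.ofRealCLM ∘ x := by funext t; simp
  have e1 : (fun t : ℝ => ((y t : ℝ) : ℂ)) = ⇑Complex.ofRealCLM ∘ y := by funext t; simp
  refine ⟨x, y, { toFun := φ
                  contDiffOn := ?_
                  mem_points := ?_
                  algebraic_zero := ?_
                  algebraic_one := ?_ }, hxC, hyC, fun t => by show φ t = _; rw [hφ], hxt, hyt,
    ⟨hx0, hy0⟩, ⟨hx1, hy1⟩, ⟨hxh, hyh⟩, hxb⟩
  · rw [contDiffOn_pi]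
    intro j
    rw [hφ]
    fin_cases j
    · simp only [Fin.zero_eta, Matrix.cons_val_zero]
      rw [e0]
      exact (Complex.ofRealCLM.contDiff.comp hxC).contDiffOn
    · simp only [Fin.mk_one, Matrix.cons_val_one, Matrix.cons_val_zero]
      rw [e1]
      exact (Complex.ofRealCLM.contDiff.comp hyC).contDiffOn
  · intro t _
    rw [mem_points_iff, hφ]
    simp only [Matrix.cons_val_zero, Matrix.cons_val_one]
    exact_mod_cast hcurve t
  · intro i
    rw [hφ]
    fin_cases i
    · simpa [hx0] using hq_alg
    · simpa [hy0] using (isAlgebraic_zero : IsAlgebraic ℚ (0 : ℂ))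
  · intro i
    rw [hφ]
    fin_cases i
    · simpa [hx1] using hq_alg
    · simpa [hy1] using (isAlgebraic_zero : IsAlgebraic ℚ (0 : ℂ))

/-! ### CM partners (`r₁ + r₃ = 2r₂`) -/

/-- **The CM partner of a real path.**  Let `f(x) = (x² − r₁)(x² − r₂)(x² − r₃)` with `r₁ + r₃ = 2r₂`
(`f(x) = F(x² − r₂)`, `F(X) = X³ − (r₂ − r₁)² X` odd) and `r₂ ∈ ℚ̄`, and let `γ₁ = (x₁, y₁)` be a path on
`C_{a,b,c}` with real `C¹` coordinates, `x₁² < 2r₂`, closed and based at `(√r₂, 0)` and through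
`(√r₁, 0)` at `t = ½`.  Then `γ₂ = (√(2r₂ − x₁²), i·y₁)` is a `C¹` path on `C_{a,b,c}`
(`f(x₂) = F(−(x₁² − r₂)) = −f(x₁) = (i y₁)²`), closed and based at `(√r₂, 0)`, through `(√r₃, 0)` at
`t = ½`, with `x₂² − r₂ = −(x₁² − r₂)` and `y₂ = i·y₁`: `φ_{−r₂} ∘ γ₂ = [i] ∘ φ_{−r₂} ∘ γ₁`. -/
theorem exists_partnerPath {A B C₀ r₁ r₂ r₃ : ℝ} (ha : a = A) (hb : b = B) (hc : c = C₀)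
    (hfac : ∀ X : ℝ, X ^ 6 + A * X ^ 4 + B * X ^ 2 + C₀ = (X ^ 2 - r₁) * (X ^ 2 - r₂) * (X ^ 2 - r₃))
    (hAP : r₁ + r₃ = 2 * r₂) (hr₁ : 0 ≤ r₁) (hr : 0 ≤ r₂) (hr₂ : IsAlgebraic ℚ (r₂ : ℂ))
    {x₁ y₁ : ℝ → ℝ} (hx₁ : ContDiff ℝ 1 x₁) (hy₁ : ContDiff ℝ 1 y₁) {γ₁ : CurvePath Cpl[a, b, c]}
    (hγ₁ : ∀ t, γ₁.toFun t = ![(x₁ t : ℂ), (y₁ t : ℂ)]) (hlt : ∀ t, x₁ t ^ 2 < 2 * r₂)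
    (h0 : x₁ 0 = √r₂ ∧ y₁ 0 = 0) (h1 : x₁ 1 = √r₂ ∧ y₁ 1 = 0)
    (hh : x₁ (1 / 2) = √r₁ ∧ y₁ (1 / 2) = 0) :
    ∃ γ₂ : CurvePath Cpl[a, b, c],
      (∀ t, γ₂.toFun t = ![((√(2 * r₂ - x₁ t ^ 2) : ℝ) : ℂ), I * (y₁ t : ℂ)]) ∧
      γ₂.toFun 0 = ![((√r₂ : ℝ) : ℂ), 0] ∧ γ₂.toFun 1 = ![((√r₂ : ℝ) : ℂ), 0] ∧
      γ₂.toFun (1 / 2) = ![((√r₃ : ℝ) : ℂ), 0] ∧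
      ∀ t, γ₂.toFun t 0 ^ 2 + -(r₂ : ℂ) = -(γ₁.toFun t 0 ^ 2 + -(r₂ : ℂ)) ∧
        γ₂.toFun t 1 = I * γ₁.toFun t 1 := by
  subst ha hb hc
  have hpos : ∀ t, 0 < 2 * r₂ - x₁ t ^ 2 := fun t => by linarith [hlt t]
  have hX2 : ∀ t, √(2 * r₂ - x₁ t ^ 2) ^ 2 = 2 * r₂ - x₁ t ^ 2 := fun t => Real.sq_sqrt (hpos t).le
  -- the curve equation of `γ₁`, as a real identity
  have hy₁sq : ∀ t ∈ Icc (0 : ℝ) 1, y₁ t ^ 2 = x₁ t ^ 6 + A * x₁ t ^ 4 + B * x₁ t ^ 2 + C₀ := by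
    intro t ht
    have h := γ₁.mem_points t ht
    rw [mem_points_iff, hγ₁] at h
    simp only [Matrix.cons_val_zero, Matrix.cons_val_one] at h
    exact_mod_cast h
  -- `f(x₂) = −f(x₁)`
  have hfx₂ : ∀ t, √(2 * r₂ - x₁ t ^ 2) ^ 6 + A * √(2 * r₂ - x₁ t ^ 2) ^ 4 +
      B * √(2 * r₂ - x₁ t ^ 2) ^ 2 + C₀ = -(x₁ t ^ 6 + A * x₁ t ^ 4 + B * x₁ t ^ 2 + C₀) := by
    intro t
    rw [hfac, hfac, hX2]
    linear_combination (-2 * (r₂ - x₁ t ^ 2) ^ 2) * hAP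
  have hq_alg : IsAlgebraic ℚ ((√r₂ : ℝ) : ℂ) := isAlgebraic_sqrt hr hr₂
  obtain ⟨φ, hφ⟩ : ∃ φ : ℝ → Fin 2 → ℂ,
      φ = fun t => ![((√(2 * r₂ - x₁ t ^ 2) : ℝ) : ℂ), I * (y₁ t : ℂ)] := ⟨_, rfl⟩
  have hφ0 : φ 0 = ![((√r₂ : ℝ) : ℂ), 0] := by
    rw [hφ]
    simp only [h0.1, h0.2, Real.sq_sqrt hr, ofReal_zero, mul_zero]
    rw [show 2 * r₂ - r₂ = r₂ by ring]
  have hφ1 : φ 1 = ![((√r₂ : ℝ) : ℂ), 0] := by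
    rw [hφ]
    simp only [h1.1, h1.2, Real.sq_sqrt hr, ofReal_zero, mul_zero]
    rw [show 2 * r₂ - r₂ = r₂ by ring]
  have hφh : φ (1 / 2) = ![((√r₃ : ℝ) : ℂ), 0] := by
    rw [hφ]
    simp only [hh.1, hh.2, Real.sq_sqrt hr₁, ofReal_zero, mul_zero]
    rw [show 2 * r₂ - r₁ = r₃ by linarith]
  have e0 : (fun t : ℝ => ((√(2 * r₂ - x₁ t ^ 2) : ℝ) : ℂ)) =
      ⇑Complex.ofRealCLM ∘ fun t => √(2 * r₂ - x₁ t ^ 2) := by funext t; simp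
  have e1 : (fun t : ℝ => I * ((y₁ t : ℝ) : ℂ)) = fun t => I * (⇑Complex.ofRealCLM ∘ y₁) t := by
    funext t; simp
  refine ⟨{ toFun := φ
            contDiffOn := ?_
            mem_points := ?_
            algebraic_zero := ?_
            algebraic_one := ?_ }, fun t => by show φ t = _; rw [hφ], hφ0, hφ1, hφh, fun t => ?_⟩
  · rw [contDiffOn_pi]
    intro j
    rw [hφ]
    fin_cases j
    · simp only [Fin.zero_eta, Matrix.cons_val_zero]
      rw [e0]
      exact (Complex.ofRealCLM.contDiff.comp
        ((contDiff_const.sub (hx₁.pow 2)).sqrt fun t => (hpos t).ne')).contDiffOn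
    · simp only [Fin.mk_one, Matrix.cons_val_one, Matrix.cons_val_zero]
      rw [e1]
      exact (contDiff_const.mul (Complex.ofRealCLM.contDiff.comp hy₁)).contDiffOn
  · intro t ht
    rw [mem_points_iff, hφ]
    simp only [Matrix.cons_val_zero, Matrix.cons_val_one]
    have key : ((-(y₁ t ^ 2) : ℝ) : ℂ) = ((√(2 * r₂ - x₁ t ^ 2) ^ 6 + A * √(2 * r₂ - x₁ t ^ 2) ^ 4 +
        B * √(2 * r₂ - x₁ t ^ 2) ^ 2 + C₀ : ℝ) : ℂ) := by
      rw [hfx₂, hy₁sq t ht]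
    push_cast at key
    linear_combination key + ((y₁ t : ℝ) : ℂ) ^ 2 * I_sq
  · intro i
    rw [hφ0]
    fin_cases i
    · simpa using hq_alg
    · simpa using (isAlgebraic_zero : IsAlgebraic ℚ (0 : ℂ))
  · intro i
    rw [hφ1]
    fin_cases i
    · simpa using hq_alg
    · simpa using (isAlgebraic_zero : IsAlgebraic ℚ (0 : ℂ))
  · show φ t 0 ^ 2 + -(r₂ : ℂ) = -(γ₁.toFun t 0 ^ 2 + -(r₂ : ℂ)) ∧ φ t 1 = I * γ₁.toFun t 1
    rw [hφ, hγ₁]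
    have h2 : (((√(2 * r₂ - x₁ t ^ 2)) ^ 2 : ℝ) : ℂ) = ((2 * r₂ - x₁ t ^ 2 : ℝ) : ℂ) := by rw [hX2]
    push_cast at h2
    constructor
    · simp only [Matrix.cons_val_zero]
      linear_combination h2
    · simp

/-- **kz1p's cycles `c₁₂`, `c₂₃` as a CM pair.**  For `f = (x² − r₁)(x² − r₂)(x² − r₃)`,
`0 < r₁ < r₂ < r₃`, `r₁ + r₃ = 2r₂`, `r₂ ∈ ℚ̄`: there are closed `C¹` paths `γ₁, γ₂` on `C_{a,b,c}` based
at the branch point `(√r₂, 0)` — `γ₁` the real oval over `[√r₁, √r₂]` (through `(√r₁, 0)` at `t = ½`),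
`γ₂` its CM partner over `[√r₂, √r₃]` (through `(√r₃, 0)` at `t = ½`, `y` purely imaginary) — with
`x₂² − r₂ = −(x₁² − r₂)` and `y₂ = i·y₁` on `[0, 1]`. -/
theorem exists_cmPartnerPair {A B C₀ r₁ r₂ r₃ ε : ℝ} (ha : a = A) (hb : b = B) (hc : c = C₀)
    (hfac : ∀ X : ℝ, X ^ 6 + A * X ^ 4 + B * X ^ 2 + C₀ = (X ^ 2 - r₁) * (X ^ 2 - r₂) * (X ^ 2 - r₃))
    (h₁ : 0 < r₁) (h₁₂ : r₁ < r₂) (h₂₃ : r₂ < r₃) (hAP : r₁ + r₃ = 2 * r₂) (hε : ε = 1 ∨ ε = -1)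
    (hr₂ : IsAlgebraic ℚ (r₂ : ℂ)) :
    ∃ γ₁ γ₂ : CurvePath Cpl[a, b, c],
      (γ₁.toFun 0 = ![((√r₂ : ℝ) : ℂ), 0] ∧ γ₁.toFun 1 = ![((√r₂ : ℝ) : ℂ), 0] ∧
        γ₁.toFun (1 / 2) = ![((√r₁ : ℝ) : ℂ), 0]) ∧
      (γ₂.toFun 0 = ![((√r₂ : ℝ) : ℂ), 0] ∧ γ₂.toFun 1 = ![((√r₂ : ℝ) : ℂ), 0] ∧
        γ₂.toFun (1 / 2) = ![((√r₃ : ℝ) : ℂ), 0]) ∧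
      (∀ t, (γ₁.toFun t 0).im = 0 ∧ (γ₁.toFun t 1).im = 0 ∧ (γ₂.toFun t 0).im = 0 ∧
        (γ₂.toFun t 1).re = 0) ∧
      ∀ t ∈ Icc (0 : ℝ) 1, γ₂.toFun t 0 ^ 2 + -(r₂ : ℂ) = -(γ₁.toFun t 0 ^ 2 + -(r₂ : ℂ)) ∧
        γ₂.toFun t 1 = I * γ₁.toFun t 1 := by
  obtain ⟨x, y, γ₁, hxC, hyC, hγ₁, -, -, h0, h1, hh, hxb⟩ :=
    exists_ovalPath ha hb hc hfac h₁ h₁₂ h₂₃ hε hr₂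
  have hlt : ∀ t, x t ^ 2 < 2 * r₂ := fun t => by
    obtain ⟨hl, hu⟩ := hxb t
    have hp0 : 0 < √r₁ := Real.sqrt_pos.2 h₁
    have hsq : x t ^ 2 ≤ √r₂ ^ 2 := pow_le_pow_left₀ (by linarith) hu 2
    rw [Real.sq_sqrt (h₁.le.trans h₁₂.le)] at hsq
    linarith
  obtain ⟨γ₂, hγ₂, h20, h21, h2h, hrel⟩ := exists_partnerPath ha hb hc hfac hAP h₁.le
    (h₁.le.trans h₁₂.le) hr₂ hxC hyC hγ₁ hlt h0 h1 hh
  refine ⟨γ₁, γ₂, ⟨?_, ?_, ?_⟩, ⟨h20, h21, h2h⟩, fun t => ?_, fun t _ => hrel t⟩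
  · rw [hγ₁, h0.1, h0.2, ofReal_zero]
  · rw [hγ₁, h1.1, h1.2, ofReal_zero]
  · rw [hγ₁, hh.1, hh.2, ofReal_zero]
  · rw [hγ₁, hγ₂]
    simp only [Matrix.cons_val_zero, Matrix.cons_val_one, ofReal_im, mul_re, I_re, I_im,
      ofReal_re, zero_mul, one_mul, zero_sub, neg_zero, and_self]

/-- **The G2-01 relation on kz1p's cycles.**  In the setting of `exists_cmPartnerPair`, with the
curve's coefficients `a = −3r₂`, `b = 3r₂² − e²`, `c = −r₂³ + e² r₂` (`e² = −A_E`, the bielliptic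
quotient `E : Y² = X³ + A_E X`, `A_E ≠ 0`) algebraic and a Bézout pair `U f + V f′ = 1` over `ℚ̄`:
there are such closed paths `γ₁` (real oval over `[√r₁, √r₂]`) and `γ₂` (its CM partner over
`[√r₂, √r₃]`) with `∫_{γ₂} x dx/2y = i·∫_{γ₁} x dx/2y`. -/
theorem relation_ovals (ha : IsAlgebraic ℚ a) (hb : IsAlgebraic ℚ b) (hc : IsAlgebraic ℚ c)
    {μ ν : Fin 3 → ℂ} (hμ : ∀ k, IsAlgebraic ℚ (μ k)) (hν : ∀ k, IsAlgebraic ℚ (ν k))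
    (hbez : Bez[a, b, c, μ, ν]) {N : ℕ} {π : Fin N → ℂ} (hπa : ∀ k, IsAlgebraic ℚ (π k))
    (hπ : IsX[π]) {AE : ℂ} (hAE : IsAlgebraic ℚ AE) (hAE0 : AE ≠ 0)
    {A B C₀ r₁ r₂ r₃ ε : ℝ} (ha' : a = A) (hb' : b = B) (hc' : c = C₀)
    (hfac : ∀ X : ℝ, X ^ 6 + A * X ^ 4 + B * X ^ 2 + C₀ = (X ^ 2 - r₁) * (X ^ 2 - r₂) * (X ^ 2 - r₃))
    (h₁ : 0 < r₁) (h₁₂ : r₁ < r₂) (h₂₃ : r₂ < r₃) (hAP : r₁ + r₃ = 2 * r₂) (hε : ε = 1 ∨ ε = -1)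
    (hr₂ : IsAlgebraic ℚ (r₂ : ℂ))
    (hsp : a = 3 * (-(r₂ : ℂ)) ∧ b = 3 * (-(r₂ : ℂ)) ^ 2 + AE ∧
      c = (-(r₂ : ℂ)) ^ 3 + AE * (-(r₂ : ℂ)) + 0) :
    ∃ γ₁ γ₂ : CurvePath Cpl[a, b, c],
      (γ₁.toFun 0 = ![((√r₂ : ℝ) : ℂ), 0] ∧ γ₁.toFun 1 = ![((√r₂ : ℝ) : ℂ), 0] ∧
        γ₁.toFun (1 / 2) = ![((√r₁ : ℝ) : ℂ), 0]) ∧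
      (γ₂.toFun 0 = ![((√r₂ : ℝ) : ℂ), 0] ∧ γ₂.toFun 1 = ![((√r₂ : ℝ) : ℂ), 0] ∧
        γ₂.toFun (1 / 2) = ![((√r₃ : ℝ) : ℂ), 0]) ∧
      (∀ t, (γ₁.toFun t 0).im = 0 ∧ (γ₁.toFun t 1).im = 0 ∧ (γ₂.toFun t 0).im = 0 ∧
        (γ₂.toFun t 1).re = 0) ∧
      Pe[Cpl[a, b, c], smooth ha hb hc hbez, θ[μ, ν, π], hasAlgCoeffs_theta hμ hν hπa, γ₂] =
        I * Pe[Cpl[a, b, c], smooth ha hb hc hbez, θ[μ, ν, π], hasAlgCoeffs_theta hμ hν hπa, γ₁] := by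
  obtain ⟨γ₁, γ₂, hγ₁, hγ₂, hreal, hrel⟩ :=
    exists_cmPartnerPair ha' hb' hc' hfac h₁ h₁₂ h₂₃ hAP hε hr₂
  exact ⟨γ₁, γ₂, hγ₁, hγ₂, hreal, relation_cmPartner ha hb hc hμ hν hbez hπa hπ hr₂.neg hAE hAE0
    hsp I_sq hrel⟩

end Summit.KontsevichZagierPeriods.KzOnePeriods.G2SDerivation

end
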